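import Mathlib.Algebra.BigOperators.Ring.Finset
import Mathlib.Algebra.Order.BigOperators.Group.Finset
import Mathlib.Data.Fintype.BigOperators
import Mathlib.Data.Fintype.Perm
import Mathlib.Data.Real.Basic
import Mathlib.Tactic
import HarnessLib
import HarnessLib.Audit

/-!
# `NoHeavyLowerTail` (crux stmt-CriticalPhenomena-4575), abstract sunflower cubic: POLYNOMIAL TRANSFER CERTIFICATES for the law-level
# payer dichotomy (C1-law) `max(a,b)·(ab − e₂(c)) ≥ e₃(c)` on products of chains — the reduction to LOCAL ORBIT inequalities, and the
# three-block median certificate as a typed finite obligation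

Support file (seat `prim-ineq-prove-1` gen 33; `--supports stmt-CriticalPhenomena-4575`).  Nothing is asserted about the crux; no `sorry`,
no named facts.  Companion of `…SunflowerCyclicStarLaw` (p233015: the dichotomy on the cyclic-star law family, ONE explicit certificate
replayed by `ring`) and `…SunflowerCyclicStarLawEquality` (p236486).  Memos: run/shared/lean/prim/prim-ineq-prove-1/
FINDING-GSATLAS-prove1-g31.md (§2 certificate atlas, §3 conjecture (C1-cert), §4c the 3-block theorem), FINDING-MASTERSPLIT-prove1-g32.md,
FINDING-CHAINCERT-prove1-g33.md (this file's blueprint).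

SETTING (`ChainCert`).  `k` blocks; block `e` is a finite chain `Fin (n e)`; points `Pt n = Π_e Fin (n e)` with the product order.  A
labelling `lab : Pt n → ℕ` is read as a map to the lattice `M_ℕ` — `0` = bottom cell `B`, `1` = kernel `A`, `i ≥ 2` = petal `i` — and
`IsMono lab` says it is monotone (kernel an up-set, bottom a down-set, comparable petal points in the same petal).  Nonnegative block
weights `w e : Fin (n e) → ℝ` give the product weight `wt w x = Π_e w e (x e)`, the cell masses `mass lab w c`, and the elementary
symmetric functions `e2`, `e3` of the petal masses (written as sums over ordered pairs / triples of petal points with increasing petal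
index).  `a = mass 1`, `b = mass 0`, Gladkov slack `AG = ab − e2`, payer slacks `row 1 0 = a·AG − e3` (Lemma A), `row 0 1 = b·AG − e3`
(Lemma B).  Every sunflower map on a Boolean cube that reads DISJOINT coordinate blocks through monotone totally ordered block summaries
is, under a product measure, an instance (block weight `w e v` = probability that block `e`'s summary is `v`; g31 memo §2b).

TRANSFER CERTIFICATES.  A pair-multiplicity function `m : Pt n → Pt n → ℕ` defines `lam m = Σ_{s,t} m(s,t)·wt s·wt t`; the claim
"`row p q − lam m·(mass p − mass q)` has nonnegative coefficients" implies `mass q ≤ mass p → e3 ≤ mass p·(mass p·mass q − e2)`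
(the LARGER pole pays).  Coefficients are extracted without polynomial algebra:
* `row_sub_lam_eq` — `row p q − lam m·(mass p − mass q) = Σ_t W(t)·ker(t)` over ordered triples `t : Fin 3 → Pt n`, with the integer
  kernel `ker` (`[p p q] − [p, petal<petal] − [petal<petal<petal] − m·([p] − [q])`);
* `sum_W_mul_nonneg_of_orbitSum` — MASTER LEMMA: the group `S₃^k` (`Sym k`) acts on triples by permuting, block by block, which point
  carries which value (`act`); `W` is invariant (`W_act`), so `|S₃^k|·Σ_t W(t)κ(t) = Σ_t W(t)·orbitSum κ t`; hence nonnegative ORBIT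
  SUMS (`orbitSum κ t = Σ_g κ(g·t)` — the coefficient of the monomial of `t`, up to a positive factor) give `Σ_t W(t)κ(t) ≥ 0`;
* `e3_le_of_localCond`, `e3_le_max_mul_AG_of_localCond` — the pole inequality and (C1-law) from the two local conditions `LocalCond`.
THREE BLOCKS.  `med/join/meet`, `IsRainbow` (three petal points with distinct petals), the MEDIAN RULE `Λ_T = {(med u, join u) : u rainbow,
med u ∈ B}`, `Λ_B = {(meet u, med u) : med u ∈ A}` (`LamT/LamB`, multiplicities `mT/mB` = indicators), and
`ThreeBlockMedianCertificate` := every monotone labelling of every product of three chains satisfies both local conditions with the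
median-rule transfers.  This finite-type statement was VERIFIED OUTSIDE LEAN (g31 §4c: reduction to ≈ 6.5·10⁵ local configurations of
the ten box types + exact enumeration, three independent implementations, minimum 0, no negative value) and is recorded here as a typed
OBLIGATION (`@[conjecture]`, never used as a fact); `e3_le_max_mul_AG_three_blocks` derives the dichotomy for ALL 3-block structures from
it.  Also typed: the lane's conjecture (C1-cert) for any number of blocks (`ChainCertConjecture`, g31 §3; exhaustive on eleven universes
incl. `2^4`, `2^5`, `[3]^3`, `2^3×[3]`, `(2,2,2,4)`, `(2,2,3,3)`) and its consequence `e3_le_max_mul_AG_of_chainCert`.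
NOT HERE: the kernel replay of the certificate (needs the three-block structure lemma + a verified enumerator; blueprint in the g33 memo),
Gladkov's `AG ≥ 0` in this generality, and the identification of `e2/e3` with `Σ_{i<j} c_i c_j` / `Σ_{i<j<l} c_i c_j c_l` over petal
masses (immediate from the definitions; not needed).
-/

namespace Summit.CriticalPhenomena.PercolationContinuityZ3.Theorems.SunflowerPartition

namespace ChainCert

open Finset

variable {k : ℕ} {n : Fin k → ℕ}

/-- A point of the product of chains `[n 0] × ⋯ × [n (k-1)]`: block `e` carries a value in `Fin (n e)`. [this work] -/
abbrev Pt (n : Fin k → ℕ) : Type := (e : Fin k) → Fin (n e)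

/-- Monotonicity of a labelling `lab : P → ℕ` read as a map to the lattice `M_ℕ` (`0` = bottom cell `B`, `1` = kernel `A`,
`i ≥ 2` = petal `i`, pairwise incomparable): `x ≤ y` forces equal labels, or `x` bottom, or `y` kernel.  Equivalently: the kernel
is an up-set, the bottom a down-set, and comparable middle points lie in the same petal. [this work] -/
def IsMono (lab : Pt n → ℕ) : Prop :=
  ∀ ⦃x y : Pt n⦄, x ≤ y → (lab x = lab y ∨ lab x = 0 ∨ lab y = 1)

/-- Product weight of a point: `wt w x = ∏_e w e (x e)` (an unnormalised product measure on the product of chains). [this work] -/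
def wt (w : (e : Fin k) → Fin (n e) → ℝ) (x : Pt n) : ℝ := ∏ e, w e (x e)

/-- Mass of the cell with label `c`: `mass lab w c = Σ_{lab x = c} wt x` (`c = 1`: kernel mass `a`; `c = 0`: bottom mass `b`;
`c ≥ 2`: petal mass `c_c`). [this work] -/
def mass (lab : Pt n → ℕ) (w : (e : Fin k) → Fin (n e) → ℝ) (c : ℕ) : ℝ :=
  ∑ x, if lab x = c then wt w x else 0

/-- Second elementary symmetric function of the petal masses, `e₂(c) = Σ_{i<j} c_i c_j`, written as the sum over ordered pairs of
petal points with increasing petal index. [this work] -/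
def e2 (lab : Pt n → ℕ) (w : (e : Fin k) → Fin (n e) → ℝ) : ℝ :=
  ∑ x, ∑ y, if 2 ≤ lab x ∧ lab x < lab y then wt w x * wt w y else 0

/-- Third elementary symmetric function of the petal masses, `e₃(c) = Σ_{i<j<l} c_i c_j c_l`, as the sum over ordered triples of
petal points with increasing petal index. [this work] -/
def e3 (lab : Pt n → ℕ) (w : (e : Fin k) → Fin (n e) → ℝ) : ℝ :=
  ∑ x, ∑ y, ∑ z, if 2 ≤ lab x ∧ lab x < lab y ∧ lab y < lab z then wt w x * wt w y * wt w z else 0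

/-- The pole-`p` payer slack with co-pole `q`: `row p q = m_p · (m_p m_q − e₂) − e₃`.  For `(p,q) = (1,0)` this is the Lemma-A slack
`F_T = a(ab − e₂) − e₃` (kernel spectators pay), for `(p,q) = (0,1)` the Lemma-B slack `F_B = b(ab − e₂) − e₃`. [this work] -/
def row (p q : ℕ) (lab : Pt n → ℕ) (w : (e : Fin k) → Fin (n e) → ℝ) : ℝ :=
  mass lab w p * (mass lab w p * mass lab w q - e2 lab w) - e3 lab w

/-- The transfer polynomial of a pair-multiplicity function `m`: `lam m = Σ_{s,t} m(s,t) · wt s · wt t`. [this work] -/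
def lam (m : Pt n → Pt n → ℕ) (w : (e : Fin k) → Fin (n e) → ℝ) : ℝ :=
  ∑ x, ∑ y, (m x y : ℝ) * (wt w x * wt w y)

/-- The integer kernel of `row p q − lam m · (m_p − m_q)` on ordered triples of points:
`[p p q] − [p, petal, petal↑] − [petal, petal↑, petal↑↑] − m(x,y)·([z = p] − [z = q])`. [this work] -/
def ker (p q : ℕ) (lab : Pt n → ℕ) (m : Pt n → Pt n → ℕ) (x y z : Pt n) : ℤ :=
  (if lab x = p ∧ lab y = p ∧ lab z = q then 1 else 0)
    - (if lab x = p ∧ 2 ≤ lab y ∧ lab y < lab z then 1 else 0)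
    - (if 2 ≤ lab x ∧ lab x < lab y ∧ lab y < lab z then 1 else 0)
    - (m x y : ℤ) * ((if lab z = p then 1 else 0) - (if lab z = q then 1 else 0))

/-- Weight of an ordered triple of points `t : Fin 3 → P`. [this work] -/
def W (w : (e : Fin k) → Fin (n e) → ℝ) (t : Fin 3 → Pt n) : ℝ := ∏ i, wt w (t i)

/-! ## Step 1: the slack minus the transfer is a weighted sum of the kernel over ordered triples -/

/-- Ordered triples as points of `P × P × P`. [this work] -/
def tripleEquiv (X : Type) : (Fin 3 → X) ≃ X × X × X where
  toFun t := (t 0, t 1, t 2)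
  invFun p := ![p.1, p.2.1, p.2.2]
  left_inv t := by
    funext i
    fin_cases i <;> rfl
  right_inv p := by rfl

/-- A sum over `Fin 3 → X` is an iterated triple sum. [this work] -/
theorem sum_fin3 {X : Type} [Fintype X] (F : X → X → X → ℝ) :
    ∑ t : Fin 3 → X, F (t 0) (t 1) (t 2) = ∑ x, ∑ y, ∑ z, F x y z := by
  rw [Fintype.sum_equiv (tripleEquiv X) (fun t => F (t 0) (t 1) (t 2)) (fun p => F p.1 p.2.1 p.2.2) (fun t => rfl)]
  rw [Fintype.sum_prod_type]
  refine Finset.sum_congr rfl fun x _ => ?_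
  rw [Fintype.sum_prod_type]

/-- The weight of a triple is the product of the three point weights. [this work] -/
theorem W_eq (w : (e : Fin k) → Fin (n e) → ℝ) (t : Fin 3 → Pt n) : W w t = wt w (t 0) * wt w (t 1) * wt w (t 2) := by
  simp [W, Fin.prod_univ_three]

/-- Pointwise form of the kernel identity. [this work] -/
theorem ker_pointwise (p q : ℕ) (lab : Pt n → ℕ) (m : Pt n → Pt n → ℕ) (w : (e : Fin k) → Fin (n e) → ℝ) (x y z : Pt n) :
    wt w x * wt w y * wt w z * (ker p q lab m x y z : ℝ) =
      (if lab x = p then wt w x else 0) * ((if lab y = p then wt w y else 0) * (if lab z = q then wt w z else 0))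
        - (if lab x = p then wt w x else 0) * (if 2 ≤ lab y ∧ lab y < lab z then wt w y * wt w z else 0)
        - (if 2 ≤ lab x ∧ lab x < lab y ∧ lab y < lab z then wt w x * wt w y * wt w z else 0)
        - ((m x y : ℝ) * (wt w x * wt w y) * (if lab z = p then wt w z else 0)
            - (m x y : ℝ) * (wt w x * wt w y) * (if lab z = q then wt w z else 0)) := by
  simp only [ker, ite_and]
  push_cast
  split_ifs <;> ring

/-- **Expansion.** `row p q − lam m · (m_p − m_q) = Σ_t W(t) · ker(t)` over ordered triples. [this work] -/
theorem row_sub_lam_eq (p q : ℕ) (lab : Pt n → ℕ) (m : Pt n → Pt n → ℕ) (w : (e : Fin k) → Fin (n e) → ℝ) :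
    row p q lab w - lam m w * (mass lab w p - mass lab w q) =
      ∑ t : Fin 3 → Pt n, W w t * (ker p q lab m (t 0) (t 1) (t 2) : ℝ) := by
  have hR : ∑ t : Fin 3 → Pt n, W w t * (ker p q lab m (t 0) (t 1) (t 2) : ℝ) =
      ∑ x, ∑ y, ∑ z, wt w x * wt w y * wt w z * (ker p q lab m x y z : ℝ) := by
    rw [← sum_fin3 (fun x y z => wt w x * wt w y * wt w z * (ker p q lab m x y z : ℝ))]
    refine Finset.sum_congr rfl fun t _ => ?_
    rw [W_eq]
  rw [hR]
  simp only [ker_pointwise, Finset.sum_sub_distrib]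
  simp only [row, mass, e2, e3, lam, mul_sub]
  simp only [Finset.sum_mul]
  simp only [Finset.mul_sum]


/-! ## Step 2: symmetrisation over the value permutations `S₃^k` -/

/-- The group acting on ordered triples: one permutation of the three slots per block. [this work] -/
abbrev Sym (k : ℕ) : Type := Fin k → Equiv.Perm (Fin 3)

/-- The action: in block `e`, slot `i` receives the value previously held by slot `g e i`.  It permutes, block by block, which of the
three points carries which of the three values; the multiset of values in every block — hence the monomial `W` — is unchanged. [this work] -/
def act (g : Sym k) (t : Fin 3 → Pt n) : Fin 3 → Pt n := fun i e => t (g e i) e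

/-- `act g` is a bijection of the set of ordered triples (inverse `act g⁻¹`). [this work] -/
def actEquiv (g : Sym k) : (Fin 3 → Pt n) ≃ (Fin 3 → Pt n) where
  toFun := act g
  invFun := act (fun e => (g e)⁻¹)
  left_inv t := by
    funext i e
    simp [act]
  right_inv t := by
    funext i e
    simp [act]

/-- The triple weight is invariant under the action. [this work] -/
theorem W_act (w : (e : Fin k) → Fin (n e) → ℝ) (g : Sym k) (t : Fin 3 → Pt n) : W w (act g t) = W w t := by
  unfold W wt act
  rw [Finset.prod_comm]
  conv_rhs => rw [Finset.prod_comm]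
  refine Finset.prod_congr rfl fun e _ => ?_
  exact Equiv.prod_comp (g e) (fun i => w e (t i e))

/-- The ORBIT SUM of an integer kernel at a triple: `Σ_{g ∈ S₃^k} κ(g·t)`.  For a triple with three distinct values in every block this
is the coefficient of the monomial `W(t)` in `Σ_t W(t) κ(t)`; in general it is a positive multiple of it. [this work] -/
def orbitSum (κ : (Fin 3 → Pt n) → ℤ) (t : Fin 3 → Pt n) : ℤ := ∑ g : Sym k, κ (act g t)

/-- **Master lemma (coefficient extraction by symmetrisation).**  If every orbit sum of `κ` is nonnegative, then
`Σ_t W(t)·κ(t) ≥ 0` for all nonnegative block weights. [this work] -/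
theorem sum_W_mul_nonneg_of_orbitSum (κ : (Fin 3 → Pt n) → ℤ) (hκ : ∀ t, 0 ≤ orbitSum κ t)
    (w : (e : Fin k) → Fin (n e) → ℝ) (hw : ∀ e i, 0 ≤ w e i) :
    0 ≤ ∑ t : Fin 3 → Pt n, W w t * (κ t : ℝ) := by
  set S := ∑ t : Fin 3 → Pt n, W w t * (κ t : ℝ) with hS
  -- for every `g`, re-indexing by `act g` gives `S = Σ_t W(t) κ(g·t)`
  have hg : ∀ g : Sym k, S = ∑ t : Fin 3 → Pt n, W w t * (κ (act g t) : ℝ) := by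
    intro g
    rw [hS, ← Equiv.sum_comp (actEquiv g) (fun t => W w t * (κ t : ℝ))]
    refine Finset.sum_congr rfl fun t _ => ?_
    simp only [actEquiv, Equiv.coe_fn_mk, W_act]
  have hcard : (Fintype.card (Sym k) : ℝ) * S = ∑ t : Fin 3 → Pt n, W w t * (orbitSum κ t : ℝ) := by
    calc (Fintype.card (Sym k) : ℝ) * S = ∑ _g : Sym k, S := by simp
      _ = ∑ g : Sym k, ∑ t : Fin 3 → Pt n, W w t * (κ (act g t) : ℝ) := Finset.sum_congr rfl fun g _ => hg g
      _ = ∑ t : Fin 3 → Pt n, ∑ g : Sym k, W w t * (κ (act g t) : ℝ) := Finset.sum_comm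
      _ = ∑ t : Fin 3 → Pt n, W w t * (orbitSum κ t : ℝ) := by
          refine Finset.sum_congr rfl fun t _ => ?_
          rw [orbitSum]; push_cast; rw [Finset.mul_sum]
  have hW : ∀ t : Fin 3 → Pt n, 0 ≤ W w t := fun t =>
    Finset.prod_nonneg fun i _ => Finset.prod_nonneg fun e _ => hw e _
  have h1 : 0 ≤ (Fintype.card (Sym k) : ℝ) * S := by
    rw [hcard]; exact Finset.sum_nonneg fun t _ => mul_nonneg (hW t) (by exact_mod_cast hκ t)
  have hpos : (0 : ℝ) < Fintype.card (Sym k) := by exact_mod_cast Fintype.card_pos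
  nlinarith

/-! ## Step 3: the payer inequalities from local orbit inequalities -/

/-- The local (orbit) condition for pole `p` / co-pole `q` with transfer multiplicities `m`: every orbit sum of the kernel is `≥ 0`.
Equivalently: the polynomial `row p q − lam m · (m_p − m_q)` has nonnegative coefficients in the block weights. [this work] -/
def LocalCond (p q : ℕ) (lab : Pt n → ℕ) (m : Pt n → Pt n → ℕ) : Prop :=
  ∀ t : Fin 3 → Pt n, 0 ≤ orbitSum (fun t => ker p q lab m (t 0) (t 1) (t 2)) t

/-- From the local condition: the transfer bound `lam m · (m_p − m_q) ≤ row p q`. [this work] -/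
theorem lam_mul_sub_le_row {p q : ℕ} {lab : Pt n → ℕ} {m : Pt n → Pt n → ℕ} (h : LocalCond p q lab m)
    (w : (e : Fin k) → Fin (n e) → ℝ) (hw : ∀ e i, 0 ≤ w e i) :
    lam m w * (mass lab w p - mass lab w q) ≤ row p q lab w := by
  have := sum_W_mul_nonneg_of_orbitSum _ h w hw
  rw [← row_sub_lam_eq] at this
  linarith

/-- Point weights are nonnegative. [this work] -/
theorem wt_nonneg (w : (e : Fin k) → Fin (n e) → ℝ) (hw : ∀ e i, 0 ≤ w e i) (x : Pt n) : 0 ≤ wt w x :=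
  Finset.prod_nonneg fun e _ => hw e _

/-- The transfer polynomial is nonnegative. [this work] -/
theorem lam_nonneg (m : Pt n → Pt n → ℕ) (w : (e : Fin k) → Fin (n e) → ℝ) (hw : ∀ e i, 0 ≤ w e i) : 0 ≤ lam m w :=
  Finset.sum_nonneg fun x _ => Finset.sum_nonneg fun y _ =>
    mul_nonneg (by positivity) (mul_nonneg (wt_nonneg w hw x) (wt_nonneg w hw y))

/-- **The pole inequality.**  Under the local condition for `(p,q)`: if `m_q ≤ m_p` then `e₃ ≤ m_p (m_p m_q − e₂)` — the larger pole
pays. [this work] -/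
theorem e3_le_of_localCond {p q : ℕ} {lab : Pt n → ℕ} {m : Pt n → Pt n → ℕ} (h : LocalCond p q lab m)
    (w : (e : Fin k) → Fin (n e) → ℝ) (hw : ∀ e i, 0 ≤ w e i) (hpq : mass lab w q ≤ mass lab w p) :
    e3 lab w ≤ mass lab w p * (mass lab w p * mass lab w q - e2 lab w) := by
  have h1 := lam_mul_sub_le_row h w hw
  have h2 : 0 ≤ lam m w * (mass lab w p - mass lab w q) := mul_nonneg (lam_nonneg m w hw) (by linarith)
  unfold row at h1
  linarith

/-- **(C1-law) from the two local conditions.**  If the pole-`T` condition holds with multiplicities `mT` and the pole-`B` condition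
with `mB`, then for all nonnegative block weights `e₃(c) ≤ max(a,b)·(ab − e₂(c))` (`a` = kernel mass, `b` = bottom mass). [this work] -/
theorem e3_le_max_mul_AG_of_localCond {lab : Pt n → ℕ} {mT mB : Pt n → Pt n → ℕ}
    (hT : LocalCond 1 0 lab mT) (hB : LocalCond 0 1 lab mB)
    (w : (e : Fin k) → Fin (n e) → ℝ) (hw : ∀ e i, 0 ≤ w e i) :
    e3 lab w ≤ max (mass lab w 1) (mass lab w 0) * (mass lab w 1 * mass lab w 0 - e2 lab w) := by
  rcases le_total (mass lab w 0) (mass lab w 1) with hle | hle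
  · rw [max_eq_left hle]
    exact e3_le_of_localCond hT w hw hle
  · rw [max_eq_right hle, mul_comm (mass lab w 1) (mass lab w 0)]
    exact e3_le_of_localCond hB w hw hle

/-- **CONJECTURE (C1-cert)** (this lane, g31 memo §3; OPEN): for every finite product of chains and every monotone labelling there are
pair multiplicities `mT`, `mB`, supported on pairs `s ≤ t` with `s` bottom and `t` kernel, satisfying the two local conditions — i.e.
level-0 polynomial transfer certificates for both poles exist.  Evidence: exact LP certificates for EVERY structure on `2^4`, `2^5`,
`{0,1,2}^3`, `2^3×{0,1,2}`, `(2,3,3)`, `(2,3,4)`, `(2,2,4)`, `(2,4,4)`, `(3,3,4)`, `(2,2,2,4)`, `(2,2,3,3)` (≈ 9.2·10⁵ classes) and ≈ 1.2·10⁴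
random structures up to `2^9`; three blocks = `ThreeBlockMedianCertificate` below.  An obligation, never a fact. [status: open] -/
@[conjecture] def ChainCertConjecture : Prop :=
  ∀ (k : ℕ) (n : Fin k → ℕ) (lab : Pt n → ℕ), IsMono lab →
    ∃ mT mB : Pt n → Pt n → ℕ,
      (∀ s t, mT s t ≠ 0 → lab s = 0 ∧ lab t = 1 ∧ s ≤ t) ∧ (∀ s t, mB s t ≠ 0 → lab s = 0 ∧ lab t = 1 ∧ s ≤ t) ∧
      LocalCond 1 0 lab mT ∧ LocalCond 0 1 lab mB

/-- (C1-cert) implies the payer dichotomy (C1-law) for every monotone structure on every finite product of chains (hence for every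
sunflower map reading disjoint blocks through monotone totally ordered summaries, under every product measure). [this work] -/
theorem e3_le_max_mul_AG_of_chainCert (hc : ChainCertConjecture) (lab : Pt n → ℕ) (hlab : IsMono lab)
    (w : (e : Fin k) → Fin (n e) → ℝ) (hw : ∀ e i, 0 ≤ w e i) :
    e3 lab w ≤ max (mass lab w 1) (mass lab w 0) * (mass lab w 1 * mass lab w 0 - e2 lab w) := by
  obtain ⟨mT, mB, -, -, hT, hB⟩ := hc k n lab hlab
  exact e3_le_max_mul_AG_of_localCond hT hB w hw

/-! ## Step 4: three blocks — the median-rule certificate and the payer dichotomy for 3-block compositions -/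

section ThreeBlocks

variable {n : Fin 3 → ℕ}

/-- Coordinatewise median of three points (in each block, the middle one of the three values). [this work] -/
def med (u : Fin 3 → Pt n) : Pt n := fun e => max (min (u 0 e) (u 1 e)) (min (max (u 0 e) (u 1 e)) (u 2 e))

/-- Coordinatewise join (maximum) of three points. [this work] -/
def join (u : Fin 3 → Pt n) : Pt n := fun e => max (max (u 0 e) (u 1 e)) (u 2 e)

/-- Coordinatewise meet (minimum) of three points. [this work] -/
def meet (u : Fin 3 → Pt n) : Pt n := fun e => min (min (u 0 e) (u 1 e)) (u 2 e)

/-- A RAINBOW: three petal points with pairwise distinct petal labels. [this work] -/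
def IsRainbow (lab : Pt n → ℕ) (u : Fin 3 → Pt n) : Prop :=
  (∀ i, 2 ≤ lab (u i)) ∧ lab (u 0) ≠ lab (u 1) ∧ lab (u 0) ≠ lab (u 2) ∧ lab (u 1) ≠ lab (u 2)

/-- `IsRainbow` is decidable. [this work] -/
instance (lab : Pt n → ℕ) (u : Fin 3 → Pt n) : Decidable (IsRainbow lab u) := by
  unfold IsRainbow; infer_instance

/-- The pole-`T` median set `Λ_T = {(med u, join u) : u rainbow, med u ∈ B}` (as a set of pairs). [this work] -/
def LamT (lab : Pt n → ℕ) (s t : Pt n) : Prop :=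
  lab s = 0 ∧ ∃ u : Fin 3 → Pt n, IsRainbow lab u ∧ med u = s ∧ join u = t

/-- The pole-`B` median set `Λ_B = {(meet u, med u) : u rainbow, med u ∈ A}`. [this work] -/
def LamB (lab : Pt n → ℕ) (s t : Pt n) : Prop :=
  lab t = 1 ∧ ∃ u : Fin 3 → Pt n, IsRainbow lab u ∧ meet u = s ∧ med u = t

/-- Membership in `Λ_T` is decidable (finite search). [this work] -/
instance (lab : Pt n → ℕ) (s t : Pt n) : Decidable (LamT lab s t) := by
  unfold LamT; infer_instance

/-- Membership in `Λ_B` is decidable (finite search). [this work] -/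
instance (lab : Pt n → ℕ) (s t : Pt n) : Decidable (LamB lab s t) := by
  unfold LamB; infer_instance

/-- The MEDIAN-RULE multiplicities for pole `T`: the indicator of `Λ_T`. [this work] -/
def mT (lab : Pt n → ℕ) (s t : Pt n) : ℕ := if LamT lab s t then 1 else 0

/-- The median-rule multiplicities for pole `B`: the indicator of `Λ_B`. [this work] -/
def mB (lab : Pt n → ℕ) (s t : Pt n) : ℕ := if LamB lab s t then 1 else 0

/-- **THE 3-BLOCK MEDIAN CERTIFICATE** (finite local statement; established OUTSIDE Lean by three independent exact enumerations —
prove-1 g31 `local_check.py`/`local_check2.py`, g32 `xloc.py`: all ≈ 6.5·10⁵ local configurations of the ten box types, minimum `0`,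
no negative value — and awaiting a kernel replay; an OBLIGATION here, never used as a fact): for every product of three finite chains and
every monotone labelling, every orbit sum of the pole-`T` kernel with the median-rule transfer `1_{Λ_T}` and of the pole-`B` kernel with
`1_{Λ_B}` is nonnegative; i.e. `F_T − λ_T(a − b)` and `F_B − λ_B(b − a)` have nonnegative coefficients. [this work; status: computer-verified, Lean-open] -/
@[conjecture] def ThreeBlockMedianCertificate : Prop :=
  ∀ (n : Fin 3 → ℕ) (lab : Pt n → ℕ), IsMono lab → LocalCond 1 0 lab (mT lab) ∧ LocalCond 0 1 lab (mB lab)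

/-- **The payer dichotomy for three blocks, from the certificate.**  For every product of three finite chains, every monotone
labelling (kernel `A` = label `1` an up-set, bottom `B` = label `0` a down-set, petals `≥ 2` with comparable petal points in the same
petal) and all nonnegative block weights: `e₃(c) ≤ max(a,b)·(ab − e₂(c))`.  Every sunflower map on a Boolean cube that reads three
disjoint coordinate blocks through monotone totally ordered block summaries, under any product measure, is an instance (block weight
`w e v` = probability that block `e`'s summary equals `v`); the cyclic-star theorem `CyclicStarLaw.e3_le_max_mul_AG` is the instance
`n = (3,3,3)`, summary = miss < partial < full. [this work] -/
theorem e3_le_max_mul_AG_three_blocks (hcert : ThreeBlockMedianCertificate) (n : Fin 3 → ℕ) (lab : Pt n → ℕ)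
    (hlab : IsMono lab) (w : (e : Fin 3) → Fin (n e) → ℝ) (hw : ∀ e i, 0 ≤ w e i) :
    e3 lab w ≤ max (mass lab w 1) (mass lab w 0) * (mass lab w 1 * mass lab w 0 - e2 lab w) :=
  e3_le_max_mul_AG_of_localCond (hcert n lab hlab).1 (hcert n lab hlab).2 w hw

end ThreeBlocks

end ChainCert

end Summit.CriticalPhenomena.PercolationContinuityZ3.Theorems.SunflowerPartition
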